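import Literature.MathematicalPhysics.QuantumFieldTheory.Federbush1986.NonAbelianDualityTranslation
import Literature.MathematicalPhysics.QuantumFieldTheory.Federbush1986.LinearCascadePlaquette

/-!
# `Federbush1986.NonAbelianDualityPlaquetteCascade` — [Federbush1987PhaseCellVI] THEOREM 2 p. 20, ingredient: the PLAQUETTE
# VALUES OF THE LOGARITHMIC CASCADE (24) of a `C¹` potential — abelian plaquette exactness of the linear part (`𝔤`-valued
# port of I (1.5)) and the `O(ℓ_s³)` bound on the plaquette values of the non-linear corrections, with constants homogeneous in
# the potential's own bounds; theorems only (no def, no named fact)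

statement-level skeleton of published theorems with citation tags; proofs where landed; nothing here is a claim about the Yang–Mills mass gap

CITATION HEADER.  P. Federbush, *A phase cell approach to Yang–Mills theory. VI. Non-abelian lattice-continuum duality*,
Ann. Inst. H. Poincaré (Physique théorique) **47** (1987) 17–23, Numdam `AIHPA_1987__47_1_17_0` [Federbush1987PhaseCellVI]
(cell paper F6; PDF held locally `run/shared/lean/pub/pub-balaban/t4/b2b-balaban-t4-lit2/pdf/fed1987-aihp47-VI.pdf`; pp. 18–23
READ AS IMAGES `run/shared/lean/pub/lit-balaban/lit-balaban-r19/renders/fedVI/fedVI-p003…p008.png`).  P. Federbush, *… I.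
Modes, lattice-continuum duality*, Commun. Math. Phys. **107** (1986) 319–329 [Federbush1986PhaseCellI], (1.4)–(1.5) p. 322,
p. 324–325 (plaquette variables of the averaging).  Unit `lit-balaban-r19` gen 5 (reader/typer r19; owner of the F6
statement file); SKELETON row **F6.Thm2** (statement of record `BlockSpinSystem.Theorem2Oriented`, `NonAbelianDuality.lean`
v5 = p249539) of `run/shared/lean/pub/lit-balaban/lit-balaban-r17/SKELETON-r17.md` — INGREDIENT #3 of its Phase-2 proof
(split agreed with the F-fold owner r17 gen 4, HOME/STATUS 05:21:04Z; plan HOME/INBOX r19 → r17).  Inputs BY NAME: the exact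
(24) `toCfg_iterBlockSpinLog_eq`, `nlCfg`, `AxialTreeV.avStep`/`apply_avStep` (`NonAbelianDualityEq25Proof`, unit r17),
the plaquette variable `AxialTreeV.plaqV` and its plaquette-exact averaging identity `AxialTreeV.plaqV_avStep`
(`LinearCascadePlaquette`, unit r17 — which also proves the abelian core `norm_plaq_linearCascade_logData_sub_le`:
`P(L^{r₀−s}λ_{r₀}) → plaqFunctionalV` at rate `792·B₂·ℓ_s·ℓ_{r₀}`), `inflBox`/`inflBox_succ` (`NonAbelianDualityLocality`),
`norm_Fprime_sub_le`, `eq31` (`NonAbelianDualityEq31Proof`), `eq26`, the covariance lemmas `F_congr_of_injOn`,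
`vars_translate_of_mem`, `iterBlockSpinLog_translate`, `logData_translate`, `norm_logData_shift_sub_le`
(`NonAbelianDualityTranslation`, this unit).  HOME `run/shared/lean/pub/lit-balaban/` (TAKING line HOME/STATUS.md
2026-08-21T05:44:43Z).

WHAT IS PRINTED.  VI (24) p. 22: «A(s) = L^{s,r}A(r) + L^{s,r−1}N^{r−1}(A(r)) + … + N^s(A(s + 1))»; (21)–(22) p. 21; (29)–(31)
p. 23; p. 23: «We will not detail the proof of Theorem 2 … the A(e, r₀) converge with better bounds as r₀ → ∞».  I p. 322
(1.5) «g_{∂P} = ∏_{p∈P} g̃_{∂p}», p. 325 «the plaquette assignments are independent of these choices».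

THE MATHEMATICS (the step of Theorem 2's proof that print leaves to the reader).  Taking the plaquette value
`P(c)(b; i, j) = c(b, i) + c(b + e_i, j) − c(b + e_j, i) − c(b, j)` of both sides of (24):
`P(A(s)) = P(L^{r−s}λ_r) + Σ_{j=s}^{r−1} P(L^{j−s}N^j(A(j+1)))`.  (§2) The abelian averaging `L` is PLAQUETTE-EXACT: `P(Lc)(b)`
is `16⁻¹Σ_δ` of the sums of `P(c)` over the four fine plaquettes of the `2 × 2` squares at `2b + δ` (I (1.5); the tree legs
cancel — `plaqV_avStep`, unit r17), so `|P(L^k c)(b)| ≤ 4^k · max{|P(c)(b′)| : b′ in the influence box}`.  (§3) The non-linear configuration `N^j(a)`,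
`a = A(j+1)`, is `F′` of the fine variables of each edge; for two PARALLEL ADJACENT edges these variable tuples are lattice
translates of each other (`paths_canonical`, up to the letters no path uses — irrelevant under injectivity of `exp`), so by
the mean-value form of (22) (`|F′(B) − F′(B′)| ≤ c₁ρ|B − B′|` for `|B|, |B′| ≤ ρ`) each of the two differences in `P(N^j(a))`
is `≤ c₁ρ·2D`, `D` a bound for `|a(f + v) − a(f)|`, `|v_k| ≤ 1`: `|P(N^j(A(j+1)))| ≤ 4c₁ρ_jD_j`.  (§4) For the cascade of the
line-integral data (7) of a `C¹` potential with `|A′| ≤ B₁′`, `|DA′| ≤ B₂′`: `ρ_j ≤ K₁B₁′ℓ_{j+1}` ((31) against the ZERO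
run — thresholds from global caps `B₁, B₂`, bound proportional to the potential's own `B₁′`) and `D_j ≤ K₂B₂′ℓ_{j+1}²`
(translation regularity, (31) with `b ∝ (B₂′ + η)ℓ`, `η → 0`), hence `|P(L^{j−s}N^j)| ≤ 4^{j−s}·4c₁K₁K₂B₁′B₂′ℓ_{j+1}³` and,
summing the geometric series, **`|P(A(s)) − P(L^{r−s}λ_r)| ≤ c₁K₁K₂·B₁′B₂′·ℓ_s³`** — `O(ℓ_s³)` against the `O(ℓ_s²)` of the
plaquette values themselves, with a constant that VANISHES with the local size of the field (as needed to sum over the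
infinitely many plaquettes of a level under the `|x|^{2+ε}` decay of Theorem 2).

WHAT THIS MODULE PROVES (theorems only; no `def`, no `Prop` definition, no named fact; axioms standard).  §1 `plaqV_add/_sum`,
`plaqV_level`; §2 `twice_add_hat_mem_box`, `norm_plaqV_avStep_le`, **`norm_plaqV_iterate_avStep_le`** (`|P(L^k c)| ≤ 4^k max|P(c)|`);
`wordSum_congr`; §3 `Fprime_congr_of_injOn`, `nlCfg_translate`,
**`norm_plaqV_nlCfg_le`**; §4 `iterBlockSpinLog_zero`, **`norm_iterBlockSpinLog_logData_le_of_le`** (size `≤ K₁B₁′ℓ_j`, uniform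
threshold), **`iterBlockSpinLog_logData_translate_sub_le_of_le`** (regularity `≤ K₂B₂′ℓ_j²`, homogeneous form),
**`norm_plaqV_iterBlockSpinLog_sub_linear_le`** (the heart: `≤ K·B₁′B₂′·ℓ_s³`).
-/

namespace Literature.MathematicalPhysics.QuantumFieldTheory.Federbush1986

noncomputable section

open Filter Metric Set
open scoped Topology BigOperators

namespace AxialTreeV

section Basic

variable {V : Type*} [AddCommGroup V]

/-- `plaqV` (unit r17, `LinearCascadePlaquette`) is additive. [cite: Federbush1986PhaseCellI, (1.4) p. 322] -/
theorem plaqV_add (c d : Cfg V) {s : ℕ} (p : Plaq s) : plaqV (c + d) p = plaqV c p + plaqV d p := by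
  simp only [plaqV, Pi.add_apply]; abel

/-- [cite: Federbush1986PhaseCellI, (1.4) p. 322] -/
theorem plaqV_sum {ι : Type*} (t : Finset ι) (c : ι → Cfg V) {s : ℕ} (p : Plaq s) :
    plaqV (∑ x ∈ t, c x) p = ∑ x ∈ t, plaqV (c x) p := by
  classical
  induction t using Finset.induction_on with
  | empty => simp [plaqV]
  | insert a t ha ih => rw [Finset.sum_insert ha, Finset.sum_insert ha, plaqV_add, ih]

/-- The plaquette value does not depend on the level index of the plaquette record. [cite: Federbush1986PhaseCellI, (1.4) p. 322] -/
theorem plaqV_level (c : Cfg V) (b : Fin 4 → ℤ) (i j : Fin 4) (s s' : ℕ) :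
    plaqV c (⟨b, i, j⟩ : Plaq s) = plaqV c (⟨b, i, j⟩ : Plaq s') := rfl

end Basic

section Normed

variable {W : Type*} [NormedAddCommGroup W] [NormedSpace ℝ W]

/-- The four fine base points `2b + δ + w`, `w ∈ {0, e_i, e_j, e_i + e_j}`, lie in the one-step box `2b + [0, 3]⁴`.
[cite: Federbush1986PhaseCellI, §1 p. 321] -/
theorem twice_add_hat_mem_box (b : Fin 4 → ℤ) (δ : Fin 4 → Bool) (w : Fin 4 → ℤ) (hw : ∀ k, 0 ≤ w k ∧ w k ≤ 2) :
    ∀ k, 2 * b k ≤ (AxialTree.twice b + AxialTree.hat δ + w) k ∧ (AxialTree.twice b + AxialTree.hat δ + w) k ≤ 2 * b k + 3 := by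
  intro k
  have h1 : 0 ≤ AxialTree.hat δ k ∧ AxialTree.hat δ k ≤ 1 := by
    unfold AxialTree.hat; split_ifs <;> simp
  obtain ⟨h2, h3⟩ := hw k
  simp only [Pi.add_apply, AxialTree.twice]
  omega

/-- **One averaging step quadruples plaquette bounds at most** (from the tree-leg cancellation `plaqV_avStep`, unit r17): if
`|plaqV c (b′; i, j)| ≤ M` on the box `2b + [0,3]⁴` then `|plaqV (avStep c) (b; i, j)| ≤ 4M`.
[cite: Federbush1986PhaseCellI, (1.4)–(1.5) p. 322] -/
theorem norm_plaqV_avStep_le (c : Cfg W) {s : ℕ} (b : Fin 4 → ℤ) (i j : Fin 4) {M : ℝ}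
    (h : ∀ b', (∀ k, 2 * b k ≤ b' k ∧ b' k ≤ 2 * b k + 3) → ‖plaqV c (⟨b', i, j⟩ : Plaq (s + 1))‖ ≤ M) :
    ‖plaqV (avStep c) (⟨b, i, j⟩ : Plaq s)‖ ≤ 4 * M := by
  rw [plaqV_avStep, norm_smul, show ‖(1 / 16 : ℝ)‖ = 1 / 16 by norm_num]
  have h0 : ∀ k, (0 : ℤ) ≤ (0 : Fin 4 → ℤ) k ∧ (0 : Fin 4 → ℤ) k ≤ 2 := fun k => by simp
  have hsi : ∀ (i : Fin 4) (k : Fin 4), (0 : ℤ) ≤ (Pi.single i 1 : Fin 4 → ℤ) k ∧ (Pi.single i 1 : Fin 4 → ℤ) k ≤ 2 := by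
    intro i k; rw [Pi.single_apply]; split_ifs <;> simp
  have hsij : ∀ k, (0 : ℤ) ≤ (Pi.single i 1 + Pi.single j 1 : Fin 4 → ℤ) k ∧
      (Pi.single i 1 + Pi.single j 1 : Fin 4 → ℤ) k ≤ 2 := by
    intro k; simp only [Pi.add_apply, Pi.single_apply]; split_ifs <;> simp
  have hterm : ∀ δ : Fin 4 → Bool,
      ‖plaqV c (⟨AxialTree.twice b + AxialTree.hat δ, i, j⟩ : Plaq (s + 1)) +
        plaqV c (⟨AxialTree.twice b + AxialTree.hat δ + Pi.single i 1, i, j⟩ : Plaq (s + 1)) +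
        plaqV c (⟨AxialTree.twice b + AxialTree.hat δ + Pi.single j 1, i, j⟩ : Plaq (s + 1)) +
        plaqV c (⟨AxialTree.twice b + AxialTree.hat δ + Pi.single i 1 + Pi.single j 1, i, j⟩ : Plaq (s + 1))‖ ≤ 4 * M := by
    intro δ
    have t0 : ‖plaqV c (⟨AxialTree.twice b + AxialTree.hat δ, i, j⟩ : Plaq (s + 1))‖ ≤ M :=
      h _ (by simpa using twice_add_hat_mem_box b δ 0 h0)
    have t1 := h _ (twice_add_hat_mem_box b δ _ (hsi i))
    have t2 := h _ (twice_add_hat_mem_box b δ _ (hsi j))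
    have t3 : ‖plaqV c (⟨AxialTree.twice b + AxialTree.hat δ + Pi.single i 1 + Pi.single j 1, i, j⟩ : Plaq (s + 1))‖ ≤ M := by
      rw [add_assoc]
      exact h _ (twice_add_hat_mem_box b δ _ hsij)
    calc _ ≤ ‖plaqV c (⟨AxialTree.twice b + AxialTree.hat δ, i, j⟩ : Plaq (s + 1)) +
          plaqV c (⟨AxialTree.twice b + AxialTree.hat δ + Pi.single i 1, i, j⟩ : Plaq (s + 1)) +
          plaqV c (⟨AxialTree.twice b + AxialTree.hat δ + Pi.single j 1, i, j⟩ : Plaq (s + 1))‖ +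
          ‖plaqV c (⟨AxialTree.twice b + AxialTree.hat δ + Pi.single i 1 + Pi.single j 1, i, j⟩ : Plaq (s + 1))‖ :=
          norm_add_le _ _
      _ ≤ M + M + M + M :=
          add_le_add ((norm_add_le _ _).trans (add_le_add ((norm_add_le _ _).trans (add_le_add t0 t1)) t2)) t3
      _ = 4 * M := by ring
  calc (1 / 16 : ℝ) * ‖∑ δ : Fin 4 → Bool, (plaqV c (⟨AxialTree.twice b + AxialTree.hat δ, i, j⟩ : Plaq (s + 1)) +
        plaqV c (⟨AxialTree.twice b + AxialTree.hat δ + Pi.single i 1, i, j⟩ : Plaq (s + 1)) +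
        plaqV c (⟨AxialTree.twice b + AxialTree.hat δ + Pi.single j 1, i, j⟩ : Plaq (s + 1)) +
        plaqV c (⟨AxialTree.twice b + AxialTree.hat δ + Pi.single i 1 + Pi.single j 1, i, j⟩ : Plaq (s + 1)))‖
      ≤ (1 / 16 : ℝ) * ∑ δ : Fin 4 → Bool, (4 * M) :=
        mul_le_mul_of_nonneg_left ((norm_sum_le _ _).trans (Finset.sum_le_sum fun δ _ => hterm δ)) (by norm_num)
    _ = 4 * M := by simp [Finset.card_univ, Fintype.card_bool]

/-- **`k` averaging steps multiply plaquette bounds by at most `4^k`**: if `|plaqV c (b′; i, j)| ≤ M` on the influence box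
`inflBox b k` then `|plaqV (avStep^[k] c) (b; i, j)| ≤ 4^k M`. [cite: Federbush1986PhaseCellI, (1.5) p. 322, (1.11) p. 324] -/
theorem norm_plaqV_iterate_avStep_le (i j : Fin 4) (k : ℕ) :
    ∀ (s : ℕ) (c : Cfg W) (b : Fin 4 → ℤ) {M : ℝ},
      (∀ b', inflBox b k b' → ‖plaqV c (⟨b', i, j⟩ : Plaq (s + k))‖ ≤ M) →
        ‖plaqV (avStep^[k] c) (⟨b, i, j⟩ : Plaq s)‖ ≤ 4 ^ k * M := by
  induction k with
  | zero =>
    intro s c b M h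
    simpa using h b (inflBox_zero b)
  | succ k ih =>
    intro s c b M h
    rw [Function.iterate_succ_apply, pow_succ, mul_assoc]
    refine ih s (avStep c) b fun b' hb' => ?_
    exact norm_plaqV_avStep_le c b' i j fun b'' hb'' => h b'' (inflBox_succ hb' hb'')

end Normed

end AxialTreeV

/-- The signed word sum depends only on the variables of the letters of the word. [cite: Federbush1986PhaseCellI, (1.1)–(1.2)
p. 322] -/
theorem wordSum_congr {V ι : Type*} [AddCommGroup V] {a a' : ι → V} (w : List (ι × Bool))
    (h : ∀ l ∈ w, a l.1 = a' l.1) : wordSum a w = wordSum a' w := by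
  induction w with
  | nil => rfl
  | cons l w ih =>
    obtain ⟨α, bb⟩ := l
    have hα : a α = a' α := h (α, bb) (by simp)
    have ih' := ih fun l' hl' => h l' (List.mem_cons_of_mem _ hl')
    simp only [wordSum, hα, ih']


namespace BlockSpinSystem

variable (S : BlockSpinSystem)

/-! ## §3 The plaquette values of the non-linear configurations `N^j(a)` -/

/-- `F′` depends only on the letters the paths use (small arguments, injectivity of `exp` on a ball).
[cite: Federbush1987PhaseCellVI, (18) p. 21] -/
theorem Fprime_congr_of_injOn (hFS : S.IsFederbushSystem) (hinj : ∃ ρ > (0 : ℝ), InjOn S.exp (ball 0 ρ)) :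
    ∃ ε > (0 : ℝ), ∀ A A' : Fin S.M → S.𝔤, (∀ α, ‖A α‖ < ε) → (∀ α, ‖A' α‖ < ε) →
      (∀ x, ∀ l ∈ S.paths x, A l.1 = A' l.1) → S.Fprime A = S.Fprime A' := by
  obtain ⟨ε, hε, hF⟩ := S.F_congr_of_injOn hFS hinj
  refine ⟨ε, hε, fun A A' hA hA' hagree => ?_⟩
  have hFL : S.FL A = S.FL A' := by
    rw [hFS.FL_abelian, hFS.FL_abelian]
    congr 1
    exact Finset.sum_congr rfl fun x _ => wordSum_congr _ (hagree x)
  simp only [Fprime, hF A A' hA hA' hagree, hFL]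

/-- The non-linear configuration at a translated edge is the one of the translated data: `N^j(a)(b + v, μ) =
N^j(a ∘ τ_{2v})(b, μ)` (small data). [cite: Federbush1987PhaseCellVI, (18) p. 21, (24) p. 22] -/
theorem nlCfg_translate (hFS : S.IsFederbushSystem) (hinj : ∃ ρ > (0 : ℝ), InjOn S.exp (ball 0 ρ)) :
    ∃ ε > (0 : ℝ), ∀ (j : ℕ) (a : Edge (j + 1) → S.𝔤) (b v : Fin 4 → ℤ) (μ : Fin 4), (∀ f, ‖a f‖ < ε) →
      S.nlCfg j a (b + v) μ = S.nlCfg j (fun f => a (f.translate fun k => 2 * v k)) b μ := by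
  obtain ⟨ε, hε, hF⟩ := S.Fprime_congr_of_injOn hFS hinj
  refine ⟨ε, hε, fun j a b v μ ha => ?_⟩
  unfold nlCfg
  refine hF _ _ (fun α => ha _) (fun α => ha _) fun x l hl => ?_
  have h := S.vars_translate_of_mem hFS j ⟨b, μ⟩ v x l hl
  rw [Edge.translate_mk] at h
  show a (S.vars j ⟨b + v, μ⟩ l.1) = a ((S.vars j ⟨b, μ⟩ l.1).translate fun k => 2 * v k)
  rw [h]

/-- **The plaquette values of `N^j(a)` are second-order small**: if the data `a` have size `≤ ρ` (small) and translation
regularity `|a(f + v) − a(f)| ≤ D` (`|v_k| ≤ 1`), then `|P(N^j(a))(b; i, k)| ≤ 4c₁ρD`, `c₁` the constant of the mean-value form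
of (22). [cite: Federbush1987PhaseCellVI, (21)–(23) p. 21, (24) p. 22] -/
theorem norm_plaqV_nlCfg_le (hFS : S.IsFederbushSystem) (hinj : ∃ ρ > (0 : ℝ), InjOn S.exp (ball 0 ρ)) :
    ∃ ε > (0 : ℝ), ∃ c₁ : ℝ, 0 ≤ c₁ ∧ ∀ (j : ℕ) (a : Edge (j + 1) → S.𝔤) (ρ D : ℝ), ρ < ε → (∀ f, ‖a f‖ ≤ ρ) →
      (∀ (f : Edge (j + 1)) (v : Fin 4 → ℤ), (∀ k, |v k| ≤ 1) → ‖a (f.translate v) - a f‖ ≤ D) →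
        ∀ (b : Fin 4 → ℤ) (i k : Fin 4), ‖AxialTreeV.plaqV (S.nlCfg j a) (⟨b, i, k⟩ : Plaq j)‖ ≤ 4 * c₁ * ρ * D := by
  obtain ⟨ε₀, hε₀, hN⟩ := S.nlCfg_translate hFS hinj
  obtain ⟨c₁, hc₁, ε'', hε'', H22⟩ := S.norm_Fprime_sub_le hFS.estimates
  refine ⟨min ε₀ ε'', lt_min hε₀ hε'', c₁, hc₁, ?_⟩
  intro j a ρ D hρ ha hreg b i k
  have hρ0 : 0 ≤ ρ := (norm_nonneg _).trans (ha ⟨b, i⟩)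
  have hD0 : 0 ≤ D := by simpa using hreg ⟨b, i⟩ 0 (fun k => by simp)
  have hsmall : ∀ f, ‖a f‖ < ε₀ := fun f => (ha f).trans_lt (hρ.trans_le (min_le_left _ _))
  have hρε : ρ < ε'' := hρ.trans_le (min_le_right _ _)
  -- one unit step twice = the translate by `2e_m`
  have hunit : ∀ m : Fin 4, ∀ k', |(Pi.single m 1 : Fin 4 → ℤ) k'| ≤ 1 := by
    intro m k'; rw [Pi.single_apply]; split_ifs <;> simp
  have htwo : ∀ (m : Fin 4) (f : Edge (j + 1)),
      f.translate (fun k' => 2 * (Pi.single m 1 : Fin 4 → ℤ) k') = (f.translate (Pi.single m 1)).translate (Pi.single m 1) := by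
    intro m f
    rw [Edge.translate_translate]
    congr 1
    funext k'
    simp only [Pi.add_apply]
    ring
  have hpair : ∀ (m : Fin 4) (f : Edge (j + 1)),
      ‖a (f.translate fun k' => 2 * (Pi.single m 1 : Fin 4 → ℤ) k') - a f‖ ≤ 2 * D := by
    intro m f
    rw [htwo]
    calc ‖a ((f.translate (Pi.single m 1)).translate (Pi.single m 1)) - a f‖
        ≤ ‖a ((f.translate (Pi.single m 1)).translate (Pi.single m 1)) - a (f.translate (Pi.single m 1))‖ +
            ‖a (f.translate (Pi.single m 1)) - a f‖ := norm_sub_le_norm_sub_add_norm_sub _ _ _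
      _ ≤ D + D := add_le_add (hreg _ _ (hunit m)) (hreg _ _ (hunit m))
      _ = 2 * D := by ring
  -- the difference of `N^j` at two parallel edges `(b′, μ)` and `(b′ + e_m, μ)`
  have hdiff : ∀ (b' : Fin 4 → ℤ) (μ m : Fin 4),
      ‖S.nlCfg j a b' μ - S.nlCfg j a (b' + Pi.single m 1) μ‖ ≤ c₁ * ρ * (2 * D) := by
    intro b' μ m
    rw [hN j a b' (Pi.single m 1) μ hsmall]
    unfold nlCfg
    have hB : ‖(fun α => a (S.vars j ⟨b', μ⟩ α))‖ ≤ ρ := (pi_norm_le_iff_of_nonneg hρ0).2 fun α => ha _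
    have hB' : ‖(fun α => a ((S.vars j ⟨b', μ⟩ α).translate fun k' => 2 * (Pi.single m 1 : Fin 4 → ℤ) k'))‖ ≤ ρ :=
      (pi_norm_le_iff_of_nonneg hρ0).2 fun α => ha _
    refine (H22 ρ hρε _ _ hB hB').trans ?_
    refine mul_le_mul_of_nonneg_left ?_ (mul_nonneg hc₁ hρ0)
    refine (pi_norm_le_iff_of_nonneg (by positivity)).2 fun α => ?_
    rw [Pi.sub_apply, norm_sub_rev]
    exact hpair m _
  -- the plaquette value = two such differences
  have e1 : AxialTreeV.plaqV (S.nlCfg j a) (⟨b, i, k⟩ : Plaq j) =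
      (S.nlCfg j a b i - S.nlCfg j a (b + Pi.single k 1) i) -
        (S.nlCfg j a b k - S.nlCfg j a (b + Pi.single i 1) k) := by
    simp only [AxialTreeV.plaqV]; abel
  rw [e1]
  calc _ ≤ ‖S.nlCfg j a b i - S.nlCfg j a (b + Pi.single k 1) i‖ + ‖S.nlCfg j a b k - S.nlCfg j a (b + Pi.single i 1) k‖ :=
        norm_sub_le _ _
    _ ≤ c₁ * ρ * (2 * D) + c₁ * ρ * (2 * D) := add_le_add (hdiff b i k) (hdiff b k i)
    _ = 4 * c₁ * ρ * D := by ring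

/-! ## §4 The logarithmic cascade of a `C¹` potential: sizes, regularity and the plaquette values, with thresholds from
global caps `B₁, B₂` and constants HOMOGENEOUS in the potential's own bounds `B₁′ ≤ B₁`, `B₂′ ≤ B₂` -/

/-- The cascade of the zero configuration is zero (`F(0) = 0`, (17)). [cite: Federbush1987PhaseCellVI, (17)–(18) p. 21, (24) p. 22] -/
theorem iterBlockSpinLog_zero (hFS : S.IsFederbushSystem) :
    ∀ (n s : ℕ), S.iterBlockSpinLog s (s + n) (fun _ => (0 : S.𝔤)) = fun _ => 0 := by
  obtain ⟨-, -, -, hF0, -⟩ := hFS.analytic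
  intro n
  induction n with
  | zero => intro s; rw [Nat.add_zero, S.iterBlockSpinLog_self]
  | succ n ih =>
    intro s
    have h1 : s + (n + 1) = (s + 1) + n := by omega
    rw [S.iterBlockSpinLog_step s (s + (n + 1)) (by omega)]
    have key : ∀ (m : ℕ) (hm : m = (s + 1) + n),
        S.iterBlockSpinLog (s + 1) m (fun _ => (0 : S.𝔤)) = fun _ => 0 := by
      intro m hm; subst hm; exact ih (s + 1)
    rw [key _ h1]
    funext e
    simp only [blockSpinLog]
    exact hF0

/-- Removing an auxiliary `η`: if `x ≤ c(B + η)` for every `0 < η < 1` (with `c ≥ 0`), then `x ≤ cB`. [folklore] -/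
private theorem le_of_forall_eta {x c B : ℝ} (hc : 0 ≤ c) (h : ∀ η : ℝ, 0 < η → η < 1 → x ≤ c * (B + η)) : x ≤ c * B := by
  refine le_of_forall_pos_le_add fun ε hε => ?_
  have hη : 0 < min (1 / 2 : ℝ) (ε / (c + 1)) := lt_min (by norm_num) (by positivity)
  have hη1 : min (1 / 2 : ℝ) (ε / (c + 1)) < 1 := (min_le_left _ _).trans_lt (by norm_num)
  have := h _ hη hη1
  have hcη : c * min (1 / 2 : ℝ) (ε / (c + 1)) ≤ ε := by
    calc c * min (1 / 2 : ℝ) (ε / (c + 1)) ≤ c * (ε / (c + 1)) := mul_le_mul_of_nonneg_left (min_le_right _ _) hc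
      _ ≤ (c + 1) * (ε / (c + 1)) := mul_le_mul_of_nonneg_right (by linarith) (by positivity)
      _ = ε := by field_simp
  linarith [mul_add c B (min (1 / 2 : ℝ) (ε / (c + 1)))]

/-- **Size of the cascade, proportional to the potential's own bound** ((26)-type, uniform threshold): there is `K₁ ≥ 1`
(scheme constant) and, for every cap `B₁`, a level `s₁` such that for every `C¹` potential with `|A′| ≤ B₁′ ≤ B₁` the
configurations of the logarithmic cascade of its data (7) satisfy `|A′(e; j)| ≤ K₁B₁′ℓ_j` at all levels `s₁ < j ≤ r` — (31)
against the ZERO run (whose cascade vanishes), with `b = (B₁′ + η)/(B₁ + 1)`, `η → 0`.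
[cite: Federbush1987PhaseCellVI, (26) p. 22, (29)–(31) p. 23, (7) p. 19] -/
theorem norm_iterBlockSpinLog_logData_le_of_le (hFS : S.IsFederbushSystem) :
    ∃ K₁ : ℝ, 1 ≤ K₁ ∧ ∀ B₁ : ℝ, 0 ≤ B₁ → ∃ s₁ : ℕ, ∀ (A' : S.Potential) (B₁' : ℝ), (∀ x μ, ‖A' x μ‖ ≤ B₁') → B₁' ≤ B₁ →
      ∀ (r j : ℕ), s₁ < j → j ≤ r → ∀ e : Edge j,
        ‖S.iterBlockSpinLog j r (S.logData A' r) e‖ ≤ K₁ * B₁' * latLen j := by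
  obtain ⟨c, H31⟩ := S.eq31 hFS
  refine ⟨2 * |c| + 1, by linarith [abs_nonneg c], fun B₁ hB₁ => ?_⟩
  obtain ⟨s₁, H31'⟩ := H31 (B₁ + 1) (by linarith)
  refine ⟨s₁, fun A' B₁' hA' hB₁' r j hj hjr e => ?_⟩
  have hB₁'0 : 0 ≤ B₁' := (norm_nonneg _).trans (hA' 0 0)
  have hℓj := latLen_pos j
  rcases eq_or_lt_of_le hjr with heq | hlt
  · subst heq
    rw [S.iterBlockSpinLog_self]
    calc ‖S.logData A' j e‖ ≤ latLen j * B₁' := S.norm_logData_le A' hA' e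
      _ ≤ (2 * |c| + 1) * B₁' * latLen j := by nlinarith [abs_nonneg c, mul_nonneg hB₁'0 hℓj.le]
  · -- (31) against the zero run
    obtain ⟨n, rfl⟩ : ∃ n, r = j + n := ⟨r - j, by omega⟩
    have hzero := S.iterBlockSpinLog_zero hFS n j
    have htop : ∀ f : Edge (j + n), ‖S.logData A' (j + n) f‖ ≤ latLen (j + n) * (B₁ + 1) := fun f =>
      (S.norm_logData_le A' hA' f).trans (by nlinarith [latLen_pos (j + n)])
    have htop0 : ∀ f : Edge (j + n), ‖(fun _ => (0 : S.𝔤)) f‖ ≤ latLen (j + n) * (B₁ + 1) := fun f => by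
      simp only [norm_zero]; nlinarith [latLen_pos (j + n)]
    have main : ∀ η : ℝ, 0 < η → η < 1 →
        ‖S.iterBlockSpinLog j (j + n) (S.logData A' (j + n)) e‖ ≤ 2 * |c| * latLen j * (B₁' + η) := by
      intro η hη hη1
      have hb0 : 0 < (B₁' + η) / (B₁ + 1) := by positivity
      have hb1 : (B₁' + η) / (B₁ + 1) < 1 := by rw [div_lt_one (by linarith)]; linarith
      have hdiff : ∀ f : Edge (j + n), ‖S.logData A' (j + n) f - (fun _ => (0 : S.𝔤)) f‖ ≤
          latLen (j + n) * ((B₁' + η) / (B₁ + 1)) * (B₁ + 1) := by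
        intro f
        rw [sub_zero, mul_assoc, div_mul_cancel₀ _ (by linarith : (B₁ + 1 : ℝ) ≠ 0)]
        exact (S.norm_logData_le A' hA' f).trans (by nlinarith [latLen_pos (j + n)])
      have h := H31' _ hb0 hb1 (j + n) _ _ htop htop0 hdiff j hj hlt e
      rw [hzero] at h
      simp only [sub_zero] at h
      calc ‖S.iterBlockSpinLog j (j + n) (S.logData A' (j + n)) e‖
          ≤ 2 * c * latLen j * ((B₁' + η) / (B₁ + 1)) * (B₁ + 1) := h
        _ = 2 * c * latLen j * (B₁' + η) := by field_simp
        _ ≤ 2 * |c| * latLen j * (B₁' + η) := by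
            have : 0 ≤ latLen j * (B₁' + η) := by positivity
            nlinarith [le_abs_self c]
    have := le_of_forall_eta (x := ‖S.iterBlockSpinLog j (j + n) (S.logData A' (j + n)) e‖)
      (c := 2 * |c| * latLen j) (B := B₁') (by positivity) main
    calc ‖S.iterBlockSpinLog j (j + n) (S.logData A' (j + n)) e‖ ≤ 2 * |c| * latLen j * B₁' := this
      _ ≤ (2 * |c| + 1) * B₁' * latLen j := by nlinarith [abs_nonneg c, mul_nonneg hB₁'0 hℓj.le]

/-- **Translation regularity, proportional to the potential's own derivative bound** (homogeneous form of
`iterBlockSpinLog_logData_translate_sub_le`): there is `K₂ ≥ 0` (scheme constant) and, for all caps `B₁, B₂`, a level `s₂`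
such that for every `C¹` potential with `|A′| ≤ B₁′ ≤ B₁`, `|DA′| ≤ B₂′ ≤ B₂`, all levels `s₂ < j ≤ r` and `|v_k| ≤ 1`:
`|A′(e + v; j) − A′(e; j)| ≤ K₂B₂′ℓ_j²`. [cite: Federbush1987PhaseCellVI, (29)–(31) p. 23, (26) p. 22, (7) p. 19;
Federbush1986PhaseCellI, Estimate 0.5 (0.7) p. 320, (2.7) p. 326] -/
theorem iterBlockSpinLog_logData_translate_sub_le_of_le (hFS : S.IsFederbushSystem)
    (hinj : ∃ ρ > (0 : ℝ), InjOn S.exp (ball 0 ρ)) :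
    ∃ K₂ : ℝ, 0 ≤ K₂ ∧ ∀ B₁ B₂ : ℝ, 0 ≤ B₁ → 0 ≤ B₂ → ∃ s₂ : ℕ, ∀ (A' : S.Potential), ContDiff ℝ 1 A' →
      ∀ (B₁' B₂' : ℝ), (∀ x μ, ‖A' x μ‖ ≤ B₁') → (∀ x μ ν, ‖fderiv ℝ (fun y => A' y μ) x (unitVec ν)‖ ≤ B₂') →
        B₁' ≤ B₁ → B₂' ≤ B₂ → ∀ (r j : ℕ), s₂ < j → j ≤ r → ∀ (e : Edge j) (v : Fin 4 → ℤ), (∀ k, |v k| ≤ 1) →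
          ‖S.iterBlockSpinLog j r (S.logData A' r) (e.translate v) - S.iterBlockSpinLog j r (S.logData A' r) e‖ ≤
            K₂ * B₂' * latLen j ^ 2 := by
  obtain ⟨c, H31⟩ := S.eq31 hFS
  obtain ⟨c₂₆, H26⟩ := S.eq26 hFS
  obtain ⟨ε, hε, Htr⟩ := S.iterBlockSpinLog_translate hFS hinj
  refine ⟨max 12 (24 * |c|), le_max_of_le_left (by norm_num), fun B₁ B₂ hB₁ hB₂ => ?_⟩
  set a₀ : ℝ := B₁ + 1 with ha₀def
  have ha₀ : 0 < a₀ := by positivity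
  obtain ⟨s₃₁, H31'⟩ := H31 a₀ ha₀
  obtain ⟨s₂₆, H26'⟩ := H26 a₀ ha₀
  set K : ℝ := a₀ * (2 * |c₂₆| + 1) + 1 with hKdef
  have hK : 0 < K := by positivity
  obtain ⟨sε, Hsε⟩ := exists_latLen_lt (show 0 < ε / K by positivity)
  obtain ⟨sb, Hsb⟩ := exists_latLen_lt (show 0 < a₀ / (12 * (B₂ + 2)) by positivity)
  refine ⟨max (max s₃₁ s₂₆) (max sε sb), ?_⟩
  intro A' hA' B₁' B₂' hB₁' hB₂' h₁ h₂ r j hj hjr e v hv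
  have hB₂'0 : 0 ≤ B₂' := (norm_nonneg _).trans (hB₂' 0 0 0)
  have hj₃₁ : s₃₁ < j := lt_of_le_of_lt ((le_max_left _ _).trans (le_max_left _ _)) hj
  have hj₂₆ : s₂₆ < j := lt_of_le_of_lt ((le_max_right _ _).trans (le_max_left _ _)) hj
  have hjε : latLen j < ε / K := Hsε j (((le_max_left _ _).trans (le_max_right _ _)).trans hj.le)
  have hjb : latLen j < a₀ / (12 * (B₂ + 2)) := Hsb j (((le_max_right _ _).trans (le_max_right _ _)).trans hj.le)
  have hℓj := latLen_pos j
  -- the shift vector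
  set W : E4 := latLen j • mkPt (fun k => (v k : ℝ)) with hWdef
  have hWn : ‖W‖ ≤ 6 * latLen j := by
    rw [hWdef, norm_smul, Real.norm_of_nonneg hℓj.le, mul_comm]
    refine mul_le_mul_of_nonneg_right (norm_mkPt_le_of_abs_le _ fun k => ?_) hℓj.le
    have : |(v k : ℝ)| ≤ 1 := by exact_mod_cast hv k
    linarith
  rcases eq_or_lt_of_le hjr with heq | hlt
  · -- top level: the data themselves
    subst heq
    rw [S.iterBlockSpinLog_self, S.logData_translate]
    calc ‖S.logData (fun y μ => A' (y + latLen j • mkPt fun k => (v k : ℝ)) μ) j e - S.logData A' j e‖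
        ≤ latLen j * (2 * B₂' * ‖W‖) := S.norm_logData_shift_sub_le A' hA' hB₂' W j e
      _ ≤ latLen j * (2 * B₂' * (6 * latLen j)) := by gcongr
      _ = 12 * B₂' * latLen j ^ 2 := by ring
      _ ≤ max 12 (24 * |c|) * B₂' * latLen j ^ 2 := by gcongr; exact le_max_left _ _
  · obtain ⟨n, rfl⟩ : ∃ n, r = j + n := ⟨r - j, by omega⟩
    have hℓr := latLen_pos (j + n)
    have hℓrj : latLen (j + n) ≤ latLen j := (latLen_lt_of_lt hlt).le
    have htop₁ : ∀ f : Edge (j + n), ‖S.logData A' (j + n) f‖ ≤ latLen (j + n) * a₀ := fun f =>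
      (S.norm_logData_le A' hB₁' f).trans (by rw [ha₀def]; nlinarith)
    have htop₂ : ∀ f : Edge (j + n), ‖S.logData (fun y μ => A' (y + W) μ) (j + n) f‖ ≤ latLen (j + n) * a₀ :=
      fun f => (S.norm_logData_le (fun y μ => A' (y + W) μ) (fun x μ => hB₁' _ _) f).trans (by rw [ha₀def]; nlinarith)
    -- smallness of every level (for the covariance)
    have hKε : latLen j * K < ε := by rwa [lt_div_iff₀ hK] at hjε
    have hsmall : ∀ i, j < i → i ≤ j + n → ∀ f : Edge i,
        ‖S.iterBlockSpinLog i (j + n) (S.logData A' (j + n)) f‖ < ε := by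
      intro i hi hi' f
      have hℓi : latLen i ≤ latLen j := (latLen_lt_of_lt hi).le
      rcases lt_or_eq_of_le hi' with hlt' | heq
      · have h26 := H26' (j + n) (S.logData A' (j + n)) htop₁ i (by omega) hlt' f
        have hℓi0 := (latLen_pos i).le
        have h1 : 2 * c₂₆ * latLen i * a₀ ≤ 2 * |c₂₆| * latLen i * a₀ :=
          mul_le_mul_of_nonneg_right (mul_le_mul_of_nonneg_right (by linarith [le_abs_self c₂₆]) hℓi0) ha₀.le
        have h2 : 2 * |c₂₆| * latLen i * a₀ ≤ 2 * |c₂₆| * latLen j * a₀ :=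
          mul_le_mul_of_nonneg_right (mul_le_mul_of_nonneg_left hℓi (by positivity)) ha₀.le
        have h3 : 2 * |c₂₆| * latLen j * a₀ ≤ latLen j * K := by
          rw [hKdef]; nlinarith [abs_nonneg c₂₆, hℓj.le, ha₀.le, mul_nonneg hℓj.le ha₀.le]
        linarith
      · subst heq
        rw [S.iterBlockSpinLog_self]
        have h3 : latLen j * a₀ ≤ latLen j * K := by
          rw [hKdef]
          nlinarith [abs_nonneg c₂₆, hℓj.le, ha₀.le, mul_nonneg hℓj.le ha₀.le,
            mul_nonneg (mul_nonneg hℓj.le ha₀.le) (abs_nonneg c₂₆)]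
        have h4 : latLen (j + n) * a₀ ≤ latLen j * a₀ := mul_le_mul_of_nonneg_right hℓrj ha₀.le
        linarith [htop₁ f]
    have hcov : S.iterBlockSpinLog j (j + n) (S.logData A' (j + n)) (e.translate v) =
        S.iterBlockSpinLog j (j + n) (S.logData (fun y μ => A' (y + W) μ) (j + n)) e := by
      rw [Htr n j (S.logData A' (j + n)) hsmall e v]
      congr 1
      funext f
      rw [S.logData_translate, latLen_smul_mkPt_pow]
    -- (31) with `b = 12(B₂′ + η)ℓ_j/a₀`
    have main : ∀ η : ℝ, 0 < η → η < 1 →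
        ‖S.iterBlockSpinLog j (j + n) (S.logData A' (j + n)) (e.translate v) -
            S.iterBlockSpinLog j (j + n) (S.logData A' (j + n)) e‖ ≤ 24 * |c| * latLen j ^ 2 * (B₂' + η) := by
      intro η hη hη1
      set b : ℝ := 12 * (B₂' + η) * latLen j / a₀ with hbdef
      have hb0 : 0 < b := by positivity
      have hb1 : b < 1 := by
        rw [hbdef, div_lt_one ha₀]
        have h12 := (lt_div_iff₀ (by positivity : (0 : ℝ) < 12 * (B₂ + 2))).1 hjb
        have : 12 * (B₂' + η) * latLen j ≤ 12 * (B₂ + 2) * latLen j := by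
          apply mul_le_mul_of_nonneg_right _ hℓj.le; linarith
        linarith
      have hba : latLen (j + n) * b * a₀ = latLen (j + n) * (12 * (B₂' + η) * latLen j) := by
        rw [hbdef]; field_simp
      have hdiff : ∀ f : Edge (j + n), ‖S.logData (fun y μ => A' (y + W) μ) (j + n) f - S.logData A' (j + n) f‖ ≤
          latLen (j + n) * b * a₀ := by
        intro f
        refine (S.norm_logData_shift_sub_le A' hA' hB₂' W (j + n) f).trans ?_
        rw [hba]
        refine mul_le_mul_of_nonneg_left ?_ hℓr.le
        calc 2 * B₂' * ‖W‖ ≤ 2 * B₂' * (6 * latLen j) := by gcongr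
          _ ≤ 12 * (B₂' + η) * latLen j := by nlinarith
      have h31 := H31' b hb0 hb1 (j + n) _ _ htop₂ htop₁ hdiff j hj₃₁ hlt e
      rw [hcov]
      calc ‖S.iterBlockSpinLog j (j + n) (S.logData (fun y μ => A' (y + W) μ) (j + n)) e -
            S.iterBlockSpinLog j (j + n) (S.logData A' (j + n)) e‖ ≤ 2 * c * latLen j * b * a₀ := h31
        _ ≤ 2 * |c| * latLen j * b * a₀ := by gcongr; exact le_abs_self _
        _ = 24 * |c| * latLen j ^ 2 * (B₂' + η) := by rw [hbdef]; field_simp; ring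
    have := le_of_forall_eta (c := 24 * |c| * latLen j ^ 2) (B := B₂') (by positivity) main
    calc _ ≤ 24 * |c| * latLen j ^ 2 * B₂' := this
      _ = 24 * |c| * B₂' * latLen j ^ 2 := by ring
      _ ≤ max 12 (24 * |c|) * B₂' * latLen j ^ 2 := by gcongr; exact le_max_right _ _

/-- **The plaquette values of the logarithmic cascade — the heart of Theorem 2's plaquette expansion.**  For Federbush's
scheme, injectivity of `exp` on a ball, caps `B₁, B₂`: there are `K ≥ 0` and a level `s₀` such that for every `C¹` potential
with `|A′| ≤ B₁′ ≤ B₁`, `|DA′| ≤ B₂′ ≤ B₂`, every `s₀ < s ≤ r` and every plaquette `(b; i, k)` of `ℒ^s`, the plaquette value of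
the level-`s` configuration `A′(·; s)` of the cascade (24) from the data (7) at level `r` differs from that of its LINEAR part
`L^{r−s}λ_r` by `≤ K·B₁′B₂′·ℓ_s³`. [cite: Federbush1987PhaseCellVI, (24) p. 22, (21)–(22) p. 21, (31) p. 23, Theorem 2 p. 20;
Federbush1986PhaseCellI, (1.5) p. 322] -/
theorem norm_plaqV_iterBlockSpinLog_sub_linear_le (hFS : S.IsFederbushSystem)
    (hinj : ∃ ρ > (0 : ℝ), InjOn S.exp (ball 0 ρ)) (B₁ B₂ : ℝ) (hB₁ : 0 ≤ B₁) (hB₂ : 0 ≤ B₂) :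
    ∃ K : ℝ, 0 ≤ K ∧ ∃ s₀ : ℕ, ∀ (A' : S.Potential), ContDiff ℝ 1 A' →
      ∀ (B₁' B₂' : ℝ), (∀ x μ, ‖A' x μ‖ ≤ B₁') → (∀ x μ ν, ‖fderiv ℝ (fun y => A' y μ) x (unitVec ν)‖ ≤ B₂') →
        B₁' ≤ B₁ → B₂' ≤ B₂ → ∀ (r s : ℕ), s₀ < s → s ≤ r → ∀ (p : Plaq s),
          ‖AxialTreeV.plaqV (AxialTreeV.toCfg (S.iterBlockSpinLog s r (S.logData A' r))) p -
              AxialTreeV.plaqV (AxialTreeV.avStep^[r - s] (AxialTreeV.toCfg (S.logData A' r))) p‖ ≤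
            K * B₁' * B₂' * latLen s ^ 3 := by
  obtain ⟨ε, hε, c₁, hc₁, HN⟩ := S.norm_plaqV_nlCfg_le hFS hinj
  obtain ⟨K₁, hK₁, HK₁⟩ := S.norm_iterBlockSpinLog_logData_le_of_le hFS
  obtain ⟨K₂, hK₂, HK₂⟩ := S.iterBlockSpinLog_logData_translate_sub_le_of_le hFS hinj
  obtain ⟨s₁, Hsize⟩ := HK₁ B₁ hB₁
  obtain ⟨s₂, Hreg⟩ := HK₂ B₁ B₂ hB₁ hB₂
  obtain ⟨sε, Hsε⟩ := exists_latLen_lt (show 0 < ε / (K₁ * B₁ + 1) by positivity)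
  have hK₁0 : 0 ≤ K₁ := by linarith
  refine ⟨c₁ * K₁ * K₂, by positivity, max (max s₁ s₂) sε, ?_⟩
  intro A' hA' B₁' B₂' hB₁' hB₂' h₁ h₂ r s hs hsr p
  obtain ⟨b, i, k⟩ := p
  have hB₁'0 : 0 ≤ B₁' := (norm_nonneg _).trans (hB₁' 0 0)
  have hB₂'0 : 0 ≤ B₂' := (norm_nonneg _).trans (hB₂' 0 0 0)
  have hs₁ : s₁ < s := lt_of_le_of_lt ((le_max_left _ _).trans (le_max_left _ _)) hs
  have hs₂ : s₂ < s := lt_of_le_of_lt ((le_max_right _ _).trans (le_max_left _ _)) hs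
  have hsε : latLen s < ε / (K₁ * B₁ + 1) := Hsε s ((le_max_right _ _).trans hs.le)
  have hℓs := latLen_pos s
  obtain ⟨n, rfl⟩ : ∃ n, r = s + n := ⟨r - s, by omega⟩
  -- (24) exactly, then plaquette values
  have h24 := S.toCfg_iterBlockSpinLog_eq hFS (s + n) (S.logData A' (s + n)) n s rfl
  rw [h24, AxialTreeV.plaqV_add, add_sub_cancel_left, AxialTreeV.plaqV_sum]
  -- each term
  have hterm : ∀ j ∈ Finset.Ico s (s + n),
      ‖AxialTreeV.plaqV (AxialTreeV.avStep^[j - s]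
          (S.nlCfg j (S.iterBlockSpinLog (j + 1) (s + n) (S.logData A' (s + n))))) (⟨b, i, k⟩ : Plaq s)‖ ≤
        c₁ * K₁ * K₂ * B₁' * B₂' * latLen s ^ 3 * ((1 / 2 : ℝ) ^ (j - s) / 2) := by
    intro j hj
    rw [Finset.mem_Ico] at hj
    have hj1 : j + 1 ≤ s + n := by omega
    have hℓj1 := latLen_pos (j + 1)
    -- sizes and regularity at level j + 1
    have hρ : ∀ f : Edge (j + 1), ‖S.iterBlockSpinLog (j + 1) (s + n) (S.logData A' (s + n)) f‖ ≤
        K₁ * B₁' * latLen (j + 1) := fun f => Hsize A' B₁' hB₁' h₁ (s + n) (j + 1) (by omega) hj1 f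
    have hD : ∀ (f : Edge (j + 1)) (v : Fin 4 → ℤ), (∀ k', |v k'| ≤ 1) →
        ‖S.iterBlockSpinLog (j + 1) (s + n) (S.logData A' (s + n)) (f.translate v) -
            S.iterBlockSpinLog (j + 1) (s + n) (S.logData A' (s + n)) f‖ ≤ K₂ * B₂' * latLen (j + 1) ^ 2 :=
      fun f v hv => Hreg A' hA' B₁' B₂' hB₁' hB₂' h₁ h₂ (s + n) (j + 1) (by omega) hj1 f v hv
    have hρε : K₁ * B₁' * latLen (j + 1) < ε := by
      have hℓ : latLen (j + 1) ≤ latLen s := (latLen_lt_of_lt (by omega : s < j + 1)).le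
      have h1 : K₁ * B₁' * latLen (j + 1) ≤ (K₁ * B₁ + 1) * latLen s := by
        calc K₁ * B₁' * latLen (j + 1) ≤ K₁ * B₁ * latLen s :=
              mul_le_mul (mul_le_mul_of_nonneg_left h₁ hK₁0) hℓ hℓj1.le (by positivity)
          _ ≤ (K₁ * B₁ + 1) * latLen s := by nlinarith
      have h2 : (K₁ * B₁ + 1) * latLen s < ε := by
        rw [lt_div_iff₀ (by positivity)] at hsε; linarith
      linarith
    have hN := HN j (S.iterBlockSpinLog (j + 1) (s + n) (S.logData A' (s + n))) _ _ hρε hρ hD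
    -- 4^{j-s} averaging steps
    have hT := AxialTreeV.norm_plaqV_iterate_avStep_le i k (j - s) s
      (S.nlCfg j (S.iterBlockSpinLog (j + 1) (s + n) (S.logData A' (s + n)))) b
      (fun b' _ => (congrArg norm (AxialTreeV.plaqV_level _ b' i k (s + (j - s)) j)).trans_le (hN b' i k))
    refine hT.trans (le_of_eq ?_)
    -- arithmetic: 4^{j-s}·4c₁(K₁B₁′ℓ_{j+1})(K₂B₂′ℓ_{j+1}²) = c₁K₁K₂B₁′B₂′ℓ_s³(1/2)^{j-s}/2
    have hℓj : latLen (j + 1) = latLen s * (1 / 2 : ℝ) ^ (j - s) / 2 := by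
      have e1 : j + 1 = (j - s) + s + 1 := by omega
      rw [e1, latLen_succ, latLen_add]
    rw [hℓj]
    have h4 : (4 : ℝ) ^ (j - s) * ((1 / 2 : ℝ) ^ (j - s)) ^ 3 = (1 / 2 : ℝ) ^ (j - s) := by
      rw [← pow_mul, mul_comm (j - s) 3, pow_mul, ← mul_pow]
      norm_num
    calc (4 : ℝ) ^ (j - s) * (4 * c₁ * (K₁ * B₁' * (latLen s * (1 / 2 : ℝ) ^ (j - s) / 2)) *
          (K₂ * B₂' * (latLen s * (1 / 2 : ℝ) ^ (j - s) / 2) ^ 2))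
        = c₁ * K₁ * K₂ * B₁' * B₂' * latLen s ^ 3 * ((4 : ℝ) ^ (j - s) * ((1 / 2 : ℝ) ^ (j - s)) ^ 3) / 2 := by ring
      _ = c₁ * K₁ * K₂ * B₁' * B₂' * latLen s ^ 3 * ((1 / 2 : ℝ) ^ (j - s) / 2) := by rw [h4]; ring
  -- the geometric sum
  calc ‖∑ j ∈ Finset.Ico s (s + n), AxialTreeV.plaqV (AxialTreeV.avStep^[j - s]
          (S.nlCfg j (S.iterBlockSpinLog (j + 1) (s + n) (S.logData A' (s + n))))) (⟨b, i, k⟩ : Plaq s)‖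
      ≤ ∑ j ∈ Finset.Ico s (s + n), c₁ * K₁ * K₂ * B₁' * B₂' * latLen s ^ 3 * ((1 / 2 : ℝ) ^ (j - s) / 2) :=
        norm_sum_le_of_le _ hterm
    _ = c₁ * K₁ * K₂ * B₁' * B₂' * latLen s ^ 3 * ((∑ m ∈ Finset.range n, (1 / 2 : ℝ) ^ m) / 2) := by
        rw [← Finset.mul_sum, ← Finset.sum_div, Finset.sum_Ico_eq_sum_range]
        simp only [add_tsub_cancel_left]
    _ ≤ c₁ * K₁ * K₂ * B₁' * B₂' * latLen s ^ 3 * (2 / 2) := by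
        gcongr
        exact sum_geometric_two_le n
    _ = c₁ * K₁ * K₂ * B₁' * B₂' * latLen s ^ 3 := by ring

end BlockSpinSystem

end

end Literature.MathematicalPhysics.QuantumFieldTheory.Federbush1986
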